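import Literature.AlgebraicGeometry.ComplexMultiplication.CyclotomicFermatCMTypesKoblitzListLevelReduction
import HarnessLib

/-!
# Koblitz's list at EVERY level prime to `6`: an elliptic-splitting Koblitz–Rohrlich factor type exists at a level `N` prime to `6`
# iff `7 ∣ N`, and then it has exact level `n₀ = 7` — from Koblitz–Rohrlich's THEOREM 2 (`|W_τ| ≤ 3`), with no census and no class number

Layer `Literature/AlgebraicGeometry/ComplexMultiplication`, namespace `…ComplexMultiplication.CyclotomicFermatCMType`; sequel of
`CyclotomicFermatCMTypesKoblitzListLevelReduction` (this lane gen 42: the reduction `n₀ = n ∕ gcd(r,s,t)` at an arbitrary level and the printed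
sentence «`H_{r,s,t}` closed ⟹ `n₀ ∈ {3, …, 60}` ∨ `n₀ > 72`», the tail `n₀ > 72` being Koblitz's theorem proper [kob], NOT held) and of
`CyclotomicFermatCMTypesTheoremTwoFactorCount` (gen 41: Koblitz–Rohrlich's Theorem 2 at every level prime to `6` in the form «every admissible
PRIMITIVE triple has `|W_τ| ≤ 3`», `card_stabilizerResidues_fermatCMType_le_three_coprimeSix`).  THEOREMS ONLY (no definition, no named fact,
no `sorry`; the only kernel decisions are at the fixed levels `5` (through the census file) and `7`).

THE SOURCES (held, read first-hand).  M. Bauer, A. Coste, C. Itzykson, P. Ruelle, *Comments on the links between su(3) modular invariants,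
simple factors in the Jacobian of Fermat curves, and rational triangular billiards*, J. Geom. Phys. **22** (1997), §3.4 p. 14 (held
`paper:arxiv-hep-th_9604104`): «Koblitz has solved the more difficult question to list all lattices `L_{r,s,t}` that have a maximal splitting in
elliptic curves. Setting `gcd(r,s,t) = n/n₀` as above, he finds that no `L_{r,s,t}` is isogenous to a product of elliptic factors unless `n₀`
belongs to the following set `{3, 4, 6, 7, 8, 12, 15, 16, 18, 20, 21, 22, 24, 30, 39, 40, 48, 60}` [kob]» and, same page, «the Shimura–Taniyama
theorem says that this can only happen if `|W_{r,s,t}| = |H_{r,s,t}| = φ(n₀)/2`. But `W_{r,s,t} ⊂ H_{r,s,t}` implies `W_{r,s,t} = H_{r,s,t}`, so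
that `H_{r,s,t}` is a group»; [kob] = N. Koblitz, *Gamma function identities and elliptic differentials on Fermat curves*, Duke Math. J. **45**
(1978) 87–99 (doi 10.1215/s0012-7094-78-04507-6; NOT held, acq-13447).  N. Koblitz, D. Rohrlich, *Simple factors in the Jacobian of a Fermat
curve*, Canad. J. Math. **30** (1978) 1183–1205 (held `paper:koblitz1978-simple-factors-jacobian-fermat-curve`), p. 1184: «`L_{r,s}` is simple
if and only if `W_{r,s} = {1}`. Suppose `W_{r,s} ≠ {1}`. Then `L_{r,s}` is isogenous to a product of `|W_{r,s}|` isomorphic simple factors»;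
pp. 1185–1186, THEOREM 2: «Suppose `N` is prime to `6`. The only lattices `L_{r,s,t}` which are not simple are those for which `{r, s, t}` is
equivalent to a triple of the form `{N/M, ⟨wN/M⟩, ⟨w²N/M⟩}` … `1 + w + w² = 0`, or to a triple of the form `{N/M, ⟨wN/M⟩, ⟨−(1+w)N/M⟩}` …
`w² = 1`, `w ≠ ±1`» (whose proof, p. 1185, shows that every `w ∈ W_{r,s,t}` satisfies `1 + w + w² = 0` or `w² = 1`).

THE POINT.  The list `∩ {N : gcd(N, 6) = 1}` is `{7}`, and for THIS part of Koblitz's theorem the source is not needed: at a level `N` prime to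
`6` every admissible primitive triple `τ` has `|W_τ| ≤ 3` (Theorem 2, tree), while «`H_τ` is a group» forces `W_τ = H_τ`, i.e.
`2|W_τ| = φ(N)` (BCIR, tree); so `φ(N) ≤ 6`, whence `N ≤ 8` (§1: `φ(N) ≥ 8` for `N ≥ 9` prime to `6`, by the eight units `±1, ±2, ±3, ±4`),
i.e. `N ∈ {5, 7}`, and the level `5` carries no such triple (the census of `CyclotomicFermatCMTypesKoblitzEllipticLevels`, one `decide` at
`n = 5`).  Consequently the open tail of the all-levels statement of the prequel is confined to levels divisible by `2` or `3`.

## What is proved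

* §1 (private) `eight_le_totient_of_coprimeSix` (`N ≥ 9`, `gcd(N, 6) = 1` ⟹ `8 ≤ φ(N)`; the eight units `±1, …, ±4`).
* §2 **`totient_le_six_of_forall_mul_mem_coprimeSix`** (N prime to `6`, `(r, s)` admissible normalised primitive, `H_{r,s,−r−s}` closed ⟹
  `φ(N) ≤ 6`: Theorem 2's `|W| ≤ 3` and BCIR's `2|W| = φ(N)`); **`exists_primitive_group_triple_iff_coprimeSix`**: for `N ≥ 3` prime to `6`, a
  primitive normalised triple with `H` a group EXISTS iff `N = 7` — KOBLITZ'S LIST AT EVERY LEVEL PRIME TO `6`.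
* §3 ALL TRIPLES: **`n0_eq_seven_of_forall_mul_mem_coprimeSix`** (N prime to `6`, any admissible normalised `(r, s)`: `H` closed ⟹
  `n₀ = N ∕ gcd(gcd(⟨r⟩,⟨s⟩), N) = 7`), `seven_dvd_of_forall_mul_mem_coprimeSix` (hence `7 ∣ N`), `not_forall_mul_mem_coprimeSix_of_not_dvd`
  (`7 ∤ N` ⟹ NO admissible triple at level `N` has `H` a group), `forall_mul_mem_seven_mul` (at `N = 7g` the triple `(g, 2g, 4g)` has `H` a
  group) and **`exists_group_triple_iff_seven_dvd_coprimeSix`** (N prime to `6`, `N ≥ 3`: some admissible normalised triple has `H` a group iff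
  `7 ∣ N`).
* §4 PRIME LEVEL: `exists_group_triple_iff_of_prime` (`p ≥ 5` prime: some admissible triple mod `p` has `H` a group iff `p = 7`),
  `forall_mul_mem_fermat_one_iff_seven` (Gordon's `S_a = H_{1,a,−1−a}`, `p ≥ 5`: `S_a` closed iff `p = 7 ∧ a ∈ {2, 4}`).
* §5 EVERY LEVEL `n`, SHARPENED TAIL: **`n0_mem_koblitzList_or_of_forall_mul_mem`** — for every admissible normalised triple with `H`
  closed: `n₀ ∈ {3, …, 60}` (the printed set) ∨ (`n₀ > 72` ∧ (`2 ∣ n₀` ∨ `3 ∣ n₀`)).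
* §6 ON ABELIAN VARIETIES (realisations of `Φ_{H_τ}` isogenous to a power of an elliptic curve, the sibling's
  `exists_isIsogeny_pow_elliptic_fermat_iff_forall_mul_mem`): `n0_eq_seven_of_exists_isIsogeny_pow_elliptic_coprimeSix`,
  `not_exists_isIsogeny_pow_elliptic_coprimeSix_of_not_dvd`, `eq_seven_of_exists_isIsogeny_pow_elliptic_prime`,
  `n0_mem_koblitzList_or_of_exists_isIsogeny_pow_elliptic`.

## Honest column / NOT here

* THE PROOF IS OURS, NOT KOBLITZ'S: [kob] is not held (acq-13447; the earlier acq-13294 carried a non-resolving DOI) and nothing is quoted from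
  it; BCIR print only the list.  The argument is Koblitz–Rohrlich's Theorem 2 (tree) read through BCIR's remark `W = H` (tree); at levels
  divisible by `2` or `3` Theorem 2 is not available (K–R: «When `N` is not prime to `6`, the situation is more complicated») and the statement
  there remains the census `n₀ ≤ 72` of the prequels plus the CITE tail, now explicitly restricted to `2 ∣ n₀ ∨ 3 ∣ n₀` (§5).
* As in all siblings a triple is taken by its normalised representative `(r, s, −r−s)`, `r, s ≠ 0`, `⟨r⟩ + ⟨s⟩ < n` (then `1 ∈ H`), «`L_{r,s,t}`
  has a maximal splitting in elliptic curves» is read as «`H_{r,s,t}` is closed under multiplication» ∕ «every realisation of `Φ_{H_{r,s,t}}` is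
  isogenous to a power of an elliptic curve», and `n₀ = n ∕ gcd(gcd(⟨r⟩, ⟨s⟩), n)`; the Fermat curve and its Jacobian are NOT constructed.
* The elliptic curve at level `7` (`E` with CM by `ℚ(√−7)`, `A_{1,2,4} ∼ E³`) is the sibling `CyclotomicFermatCMTypesFixedFieldOfStabilizer`'s,
  not re-derived.

## References

* [BauerCosteItzyksonRuelle1997] M. Bauer, A. Coste, C. Itzykson, P. Ruelle, J. Geom. Phys. 22 (1997) 134–189, §3.4 (p. 14).
* [KoblitzRohrlich1978] N. Koblitz, D. Rohrlich, Canad. J. Math. 30 (1978) 1183–1205, §1 (p. 1184), Theorem 2 (pp. 1185–1186).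
* [kob] N. Koblitz, Duke Math. J. 45 (1978) 87–99 — cited for the statement of the full list only; not held, not used.

## Provenance

Cell `pub-hodgecm2` (COR-CM), literature seat `lit-deligne-3` gen 43 (claim KOBLITZ-COPRIME-SIX; count-neutral, own lane).  HC_CM is NOT proved
and nothing here bears on it.
-/

noncomputable section

open NumberField

namespace Literature.AlgebraicGeometry.ComplexMultiplication

open CategoryTheory CategoryTheory.Limits
open Literature.AlgebraicGeometry.Motives (CMType AbelianVariety)
open Literature.AlgebraicGeometry.Motives.AbelianVariety
open Literature.NumberTheory.ComplexMultiplication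
open Literature.AlgebraicGeometry.HodgeTheory
open Literature.AlgebraicGeometry.Pohlmann1968 Literature.AlgebraicGeometry.Pohlmann1968.Cyclotomic
open CyclotomicCMTypeResidueSets (IsCMResidueSet unitResidues residueSet residueSet_cmTypeOfResidues isCMResidueSet_residueSet)

namespace CyclotomicFermatCMType

/-! ## §1 `φ(N) ≥ 8` for `N ≥ 9` prime to `6` -/

section Totient

/-- **`φ(N) ≥ 8` for `N ≥ 9` prime to `6`**: the eight residues `1, 2, 3, 4, N−4, N−3, N−2, N−1` are prime to `N` and pairwise distinct.
[folklore] -/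
private theorem eight_le_totient_of_coprimeSix {N : ℕ} (h9 : 9 ≤ N) (hN2 : Nat.Coprime 2 N) (hN3 : Nat.Coprime 3 N) : 8 ≤ N.totient := by
  classical
  rw [Nat.totient_eq_card_coprime]
  set A : Finset ℕ := {1, 2, 3, 4} with hA
  set B : Finset ℕ := A.image fun a => N - a with hB
  have hAcop : ∀ a ∈ A, N.Coprime a := by
    intro a ha
    simp only [hA, Finset.mem_insert, Finset.mem_singleton] at ha
    rcases ha with rfl | rfl | rfl | rfl
    · exact Nat.coprime_one_right N
    · exact hN2.symm
    · exact hN3.symm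
    · have h4 : Nat.Coprime (2 ^ 2) N := Nat.Coprime.pow_left 2 hN2
      exact h4.symm
  have hAlt : ∀ a ∈ A, 1 ≤ a ∧ a ≤ 4 := by
    intro a ha
    simp only [hA, Finset.mem_insert, Finset.mem_singleton] at ha
    rcases ha with rfl | rfl | rfl | rfl <;> omega
  have hsub : A ∪ B ⊆ (Finset.range N).filter N.Coprime := by
    intro x hx
    rw [Finset.mem_filter, Finset.mem_range]
    rcases Finset.mem_union.1 hx with hxA | hxB
    · obtain ⟨h1, h4⟩ := hAlt x hxA
      exact ⟨by omega, hAcop x hxA⟩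
    · obtain ⟨a, ha, rfl⟩ := Finset.mem_image.1 hxB
      obtain ⟨ha1, ha4⟩ := hAlt a ha
      exact ⟨by omega, (Nat.coprime_self_sub_right (by omega)).2 (hAcop a ha)⟩
  have hdisj : Disjoint A B := by
    rw [Finset.disjoint_left]
    intro x hxA hxB
    obtain ⟨a, ha, hax⟩ := Finset.mem_image.1 hxB
    have h1 := hAlt x hxA
    have h2 := hAlt a ha
    omega
  have hcardA : A.card = 4 := by rw [hA]; decide
  have hcardB : B.card = 4 := by
    rw [hB, Finset.card_image_of_injOn, hcardA]
    intro a ha b hb hab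
    have h1 := hAlt a ha
    have h2 := hAlt b hb
    simp only at hab
    omega
  calc 8 = (A ∪ B).card := by rw [Finset.card_union_of_disjoint hdisj, hcardA, hcardB]
    _ ≤ ((Finset.range N).filter N.Coprime).card := Finset.card_le_card hsub

end Totient

/-! ## §2 Koblitz's list at a level prime to `6`: a primitive elliptic triple exists iff `N = 7` -/

section CoprimeSix

variable {N : ℕ} [NeZero N]

omit [NeZero N] in
/-- Primitivity in the census form `gcd(gcd(⟨r⟩, ⟨s⟩), N) = 1` gives Koblitz–Rohrlich's «g.c.d.`(N, r, s, t) = 1`» (no prime of `N` divides all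
three representatives). [cite: KoblitzRohrlich1978, §1 (p. 1183), §2 (p. 1187)] -/
theorem primitive_of_gcd_gcd_eq_one {r s t : ZMod N} (h : Nat.gcd (Nat.gcd r.val s.val) N = 1) :
    ∀ q : ℕ, q.Prime → q ∣ N → ¬(q ∣ r.val ∧ q ∣ s.val ∧ q ∣ t.val) := by
  rintro q hq hqN ⟨hqr, hqs, -⟩
  have hdvd : q ∣ Nat.gcd (Nat.gcd r.val s.val) N := Nat.dvd_gcd (Nat.dvd_gcd hqr hqs) hqN
  rw [h] at hdvd
  exact hq.one_lt.ne' (Nat.dvd_one.1 hdvd)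

omit [NeZero N] in
/-- The third entry `−r−s` of a normalised triple is non-zero. [cite: KoblitzRohrlich1978, §1 (p. 1184)] -/
theorem neg_add_ne_zero_of_val_add_lt {r s : ZMod N} (hr : r ≠ 0) (hrs : r.val + s.val < N) : (-(r + s) : ZMod N) ≠ 0 := by
  intro h
  have h0 : r + s = 0 := neg_eq_zero.1 h
  have hadd : (r + s).val = r.val + s.val := ZMod.val_add_of_lt hrs
  rw [h0, ZMod.val_zero] at hadd
  have hr0 : r.val ≠ 0 := fun h' => hr ((ZMod.val_eq_zero r).1 h')
  omega

/-- **«`H_{r,s,t}` is a group» FORCES `φ(N) ≤ 6` AT A LEVEL PRIME TO `6`**: for an admissible normalised PRIMITIVE triple `(r, s, −r−s)`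
modulo `N`, `gcd(N, 6) = 1`, whose `H` is closed under multiplication, `φ(N) = 2|W| ≤ 6` — Koblitz–Rohrlich's Theorem 2 (`|W_τ| ≤ 3`, tree
`card_stabilizerResidues_fermatCMType_le_three_coprimeSix`) and «`W ⊂ H` implies `W = H`» (`2|W| = φ(N)` iff `H` closed, tree).
[cite: KoblitzRohrlich1978, Theorem 2 (pp. 1185–1186)] [cite: BauerCosteItzyksonRuelle1997, §3.4] -/
theorem totient_le_six_of_forall_mul_mem_coprimeSix (hN2 : Nat.Coprime 2 N) (hN3 : Nat.Coprime 3 N) {r s : ZMod N}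
    (hr : r ≠ 0) (hs : s ≠ 0) (hrs : r.val + s.val < N) (hprim : Nat.gcd (Nat.gcd r.val s.val) N = 1)
    (hcl : ∀ a ∈ fermatCMType N r s (-(r + s)), ∀ b ∈ fermatCMType N r s (-(r + s)), a * b ∈ fermatCMType N r s (-(r + s))) :
    N.totient ≤ 6 := by
  have ht : (-(r + s) : ZMod N) ≠ 0 := neg_add_ne_zero_of_val_add_lt hr hrs
  have hrst : r + s + -(r + s) = 0 := by ring
  have hS : IsCMResidueSet N (fermatCMType N r s (-(r + s))) := isCMResidueSet_fermatCMType_of_ne_zero hr hs ht hrst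
  have h1 : (1 : ZMod N) ∈ fermatCMType N r s (-(r + s)) := one_mem_fermatCMType_of_val_add_lt hr hrs
  have hW := (two_mul_card_stabilizerResidues_eq_totient_iff_forall_mul_mem hS h1).2 hcl
  have hW3 := card_stabilizerResidues_fermatCMType_le_three_coprimeSix hN2 hN3 hr hs ht hrst (primitive_of_gcd_gcd_eq_one hprim)
  omega

/-- **KOBLITZ'S LIST AT EVERY LEVEL PRIME TO `6`.**  For `N ≥ 3` with `gcd(N, 6) = 1`: a primitive normalised triple `(r, s, −r−s)` modulo
`N` (`r, s ≠ 0`, `⟨r⟩ + ⟨s⟩ < N`, `gcd(r, s, N) = 1`) with `H_{r,s,t}` closed under multiplication EXISTS iff `N = 7` — the printed set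
`{3, 4, 6, 7, 8, 12, 15, 16, 18, 20, 21, 22, 24, 30, 39, 40, 48, 60}` meets the levels prime to `6` in `{7}` exactly, with NO bound on `N`
(`φ(N) ≤ 6` ⟹ `N ≤ 8` by §1 ⟹ `N ∈ {5, 7}`; the level `5` by the census, the level `7` by the witness `(1, 2, 4)`).
[cite: BauerCosteItzyksonRuelle1997, §3.4] [cite: KoblitzRohrlich1978, Theorem 2 (pp. 1185–1186)] -/
theorem exists_primitive_group_triple_iff_coprimeSix (N : ℕ) [hNz : NeZero N] (h3 : 3 ≤ N) (hN2 : Nat.Coprime 2 N)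
    (hN3 : Nat.Coprime 3 N) :
    (∃ r s : ZMod N, r ≠ 0 ∧ s ≠ 0 ∧ r.val + s.val < N ∧ Nat.gcd (Nat.gcd r.val s.val) N = 1 ∧
      ∀ a ∈ fermatCMType N r s (-(r + s)), ∀ b ∈ fermatCMType N r s (-(r + s)), a * b ∈ fermatCMType N r s (-(r + s))) ↔
    N = 7 := by
  constructor
  · rintro ⟨r, s, hr, hs, hrs, hprim, hcl⟩
    have h6 := totient_le_six_of_forall_mul_mem_coprimeSix hN2 hN3 hr hs hrs hprim hcl
    have h9 : N < 9 := by
      by_contra h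
      have h8 := eight_le_totient_of_coprimeSix (N := N) (by omega) hN2 hN3
      omega
    interval_cases N
    · exact absurd hN3 (by decide)
    · exact absurd hN2 (by decide)
    · have h5 := (exists_primitive_group_triple_iff_of_le_thirty 5 (by norm_num) (by norm_num)).1
        ⟨r, s, hr, hs, hrs, hprim, hcl⟩
      exact absurd h5 (by decide)
    · exact absurd hN2 (by decide)
    · rfl
    · exact absurd hN2 (by decide)
  · rintro rfl
    exact exists_primitive_group_triple_of_mem_koblitzList (by decide)

/-- In particular at a level `N ≠ 7` prime to `6` NO primitive normalised triple has `H` a group (no bound on `N`).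
[cite: BauerCosteItzyksonRuelle1997, §3.4] [cite: KoblitzRohrlich1978, Theorem 2 (pp. 1185–1186)] -/
theorem not_exists_primitive_group_triple_coprimeSix (N : ℕ) [NeZero N] (hN2 : Nat.Coprime 2 N) (hN3 : Nat.Coprime 3 N)
    (hN7 : N ≠ 7) :
    ¬∃ r s : ZMod N, r ≠ 0 ∧ s ≠ 0 ∧ r.val + s.val < N ∧ Nat.gcd (Nat.gcd r.val s.val) N = 1 ∧
      ∀ a ∈ fermatCMType N r s (-(r + s)), ∀ b ∈ fermatCMType N r s (-(r + s)), a * b ∈ fermatCMType N r s (-(r + s)) := by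
  rintro ⟨r, s, hr, hs, hrs, hprim, hcl⟩
  have hrv : 0 < r.val := Nat.pos_of_ne_zero fun h => hr ((ZMod.val_eq_zero r).1 h)
  have hsv : 0 < s.val := Nat.pos_of_ne_zero fun h => hs ((ZMod.val_eq_zero s).1 h)
  have h3 : 3 ≤ N := by omega
  exact hN7 ((exists_primitive_group_triple_iff_coprimeSix N h3 hN2 hN3).1 ⟨r, s, hr, hs, hrs, hprim, hcl⟩)

end CoprimeSix

/-! ## §3 All triples at a level prime to `6`: `H` closed ⟹ `n₀ = 7`; some elliptic triple iff `7 ∣ N` -/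

section AllTriples

variable {N : ℕ} [NeZero N]

/-- **`n₀ = 7` FOR EVERY ELLIPTIC TRIPLE AT A LEVEL PRIME TO `6`**: for an admissible normalised pair `(r, s)` modulo `N`, `gcd(N, 6) = 1`
(no primitivity asked), if `H_{r,s,−r−s}` is closed under multiplication then `n₀ = N ∕ gcd(gcd(⟨r⟩, ⟨s⟩), N) = 7` («Setting `gcd(r,s,t) =
n/n₀` … no `L_{r,s,t}` is isogenous to a product of elliptic factors unless `n₀` belongs to» the list; the reduction to the primitive triple of
level `n₀` is the prequel's, and `n₀ ∣ N` is again prime to `6`). [cite: BauerCosteItzyksonRuelle1997, §3.4] [cite: KoblitzRohrlich1978, §2 (p. 1187)] -/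
theorem n0_eq_seven_of_forall_mul_mem_coprimeSix (hN2 : Nat.Coprime 2 N) (hN3 : Nat.Coprime 3 N) {r s : ZMod N} (hr : r ≠ 0)
    (hs : s ≠ 0) (hrs : r.val + s.val < N)
    (hcl : ∀ a ∈ fermatCMType N r s (-(r + s)), ∀ b ∈ fermatCMType N r s (-(r + s)), a * b ∈ fermatCMType N r s (-(r + s))) :
    N / Nat.gcd (Nat.gcd r.val s.val) N = 7 := by
  obtain ⟨g, m, r₁, s₁, hg, hn, hm, hr1, hs1, hr0, hs0, hlt, h3, hprim⟩ := exists_reduced_primitive hr hs hrs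
  rw [hm]
  haveI : NeZero m := ⟨by omega⟩
  have hcl' := (forall_mul_mem_iff_reduced hn hg hr1 hs1 hr0 hlt).1 hcl
  have hmN : m ∣ N := ⟨g, by rw [mul_comm]; exact hn.symm⟩
  have hm2 : Nat.Coprime 2 m := Nat.Coprime.coprime_dvd_right hmN hN2
  have hm3 : Nat.Coprime 3 m := Nat.Coprime.coprime_dvd_right hmN hN3
  have hr1v : ((r₁ : ℕ) : ZMod m).val = r₁ := by rw [ZMod.val_natCast, Nat.mod_eq_of_lt (by omega)]
  have hs1v : ((s₁ : ℕ) : ZMod m).val = s₁ := by rw [ZMod.val_natCast, Nat.mod_eq_of_lt (by omega)]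
  have hr' : ((r₁ : ℕ) : ZMod m) ≠ 0 := fun h => by
    have h1 := (ZMod.val_eq_zero _).2 h
    rw [hr1v] at h1
    omega
  have hs' : ((s₁ : ℕ) : ZMod m) ≠ 0 := fun h => by
    have h1 := (ZMod.val_eq_zero _).2 h
    rw [hs1v] at h1
    omega
  have hlt' : ((r₁ : ℕ) : ZMod m).val + ((s₁ : ℕ) : ZMod m).val < m := by rw [hr1v, hs1v]; exact hlt
  have hprim' : Nat.gcd (Nat.gcd ((r₁ : ℕ) : ZMod m).val ((s₁ : ℕ) : ZMod m).val) m = 1 := by rw [hr1v, hs1v]; exact hprim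
  exact (exists_primitive_group_triple_iff_coprimeSix m h3 hm2 hm3).1 ⟨_, _, hr', hs', hlt', hprim', hcl'⟩

/-- Hence **`7 ∣ N`** as soon as some admissible normalised triple at a level `N` prime to `6` has `H` a group.
[cite: BauerCosteItzyksonRuelle1997, §3.4] -/
theorem seven_dvd_of_forall_mul_mem_coprimeSix (hN2 : Nat.Coprime 2 N) (hN3 : Nat.Coprime 3 N) {r s : ZMod N} (hr : r ≠ 0)
    (hs : s ≠ 0) (hrs : r.val + s.val < N)
    (hcl : ∀ a ∈ fermatCMType N r s (-(r + s)), ∀ b ∈ fermatCMType N r s (-(r + s)), a * b ∈ fermatCMType N r s (-(r + s))) :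
    7 ∣ N := by
  have h7 := n0_eq_seven_of_forall_mul_mem_coprimeSix hN2 hN3 hr hs hrs hcl
  have hdvd : Nat.gcd (Nat.gcd r.val s.val) N ∣ N := Nat.gcd_dvd_right _ _
  refine ⟨Nat.gcd (Nat.gcd r.val s.val) N, ?_⟩
  rw [← h7, Nat.div_mul_cancel hdvd]

/-- **At a level `N` prime to `42` (prime to `6` and to `7`) NO admissible triple whatsoever has `H_{r,s,t}` a group** — no Koblitz–Rohrlich
factor type of `ℚ(ζ_N)` splits into elliptic curves. [cite: BauerCosteItzyksonRuelle1997, §3.4] [cite: KoblitzRohrlich1978, Theorem 2 (pp. 1185–1186)] -/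
theorem not_forall_mul_mem_coprimeSix_of_not_dvd (hN2 : Nat.Coprime 2 N) (hN3 : Nat.Coprime 3 N) (hN7 : ¬7 ∣ N) {r s : ZMod N}
    (hr : r ≠ 0) (hs : s ≠ 0) (hrs : r.val + s.val < N) :
    ¬∀ a ∈ fermatCMType N r s (-(r + s)), ∀ b ∈ fermatCMType N r s (-(r + s)), a * b ∈ fermatCMType N r s (-(r + s)) :=
  fun hcl => hN7 (seven_dvd_of_forall_mul_mem_coprimeSix hN2 hN3 hr hs hrs hcl)

/-- The level-`7` witness: `H_{1,2,4} = {1, 2, 4}` is closed under multiplication (kernel). [cite: BauerCosteItzyksonRuelle1997, §3.3–§3.4] -/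
theorem forall_mul_mem_fermat_seven_one_two :
    ∀ a ∈ fermatCMType 7 ((1 : ℕ) : ZMod 7) ((2 : ℕ) : ZMod 7) (-(((1 : ℕ) : ZMod 7) + ((2 : ℕ) : ZMod 7))),
      ∀ b ∈ fermatCMType 7 ((1 : ℕ) : ZMod 7) ((2 : ℕ) : ZMod 7) (-(((1 : ℕ) : ZMod 7) + ((2 : ℕ) : ZMod 7))),
        a * b ∈ fermatCMType 7 ((1 : ℕ) : ZMod 7) ((2 : ℕ) : ZMod 7) (-(((1 : ℕ) : ZMod 7) + ((2 : ℕ) : ZMod 7))) := by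
  decide

/-- **At every multiple `N = 7g` of `7` the (non-primitive for `g > 1`) triple `(g, 2g, 4g)` has `H` a group** — it is the level-`7` triple
`(1, 2, 4)` pulled back (closure is invariant under the reduction, prequel `forall_mul_mem_iff_reduced`). [cite: BauerCosteItzyksonRuelle1997, §3.4]
[cite: KoblitzRohrlich1978, §1 (pp. 1183–1184)] -/
theorem forall_mul_mem_seven_mul {g : ℕ} (hg : 0 < g) (hN : g * 7 = N) :
    ∀ a ∈ fermatCMType N ((g : ℕ) : ZMod N) ((2 * g : ℕ) : ZMod N) (-(((g : ℕ) : ZMod N) + ((2 * g : ℕ) : ZMod N))),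
      ∀ b ∈ fermatCMType N ((g : ℕ) : ZMod N) ((2 * g : ℕ) : ZMod N) (-(((g : ℕ) : ZMod N) + ((2 * g : ℕ) : ZMod N))),
        a * b ∈ fermatCMType N ((g : ℕ) : ZMod N) ((2 * g : ℕ) : ZMod N) (-(((g : ℕ) : ZMod N) + ((2 * g : ℕ) : ZMod N))) := by
  have hrv : (((g : ℕ) : ZMod N)).val = g * 1 := by rw [ZMod.val_natCast, Nat.mod_eq_of_lt (by omega), mul_one]
  have hsv : (((2 * g : ℕ) : ZMod N)).val = g * 2 := by rw [ZMod.val_natCast, Nat.mod_eq_of_lt (by omega), mul_comm]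
  exact (forall_mul_mem_iff_reduced (m := 7) hN hg hrv hsv one_pos (by norm_num)).2 forall_mul_mem_fermat_seven_one_two

/-- **AT A LEVEL PRIME TO `6`, SOME K–R FACTOR TYPE SPLITS INTO ELLIPTIC CURVES IFF `7 ∣ N`**: for `N ≥ 3` with `gcd(N, 6) = 1`, an admissible
normalised triple (primitive or not) with `H_{r,s,t}` closed under multiplication exists iff `7 ∣ N` (and then every such triple has `n₀ = 7`,
`n0_eq_seven_of_forall_mul_mem_coprimeSix`). [cite: BauerCosteItzyksonRuelle1997, §3.4] [cite: KoblitzRohrlich1978, Theorem 2 (pp. 1185–1186)] -/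
theorem exists_group_triple_iff_seven_dvd_coprimeSix (N : ℕ) [NeZero N] (hN2 : Nat.Coprime 2 N) (hN3 : Nat.Coprime 3 N) :
    (∃ r s : ZMod N, r ≠ 0 ∧ s ≠ 0 ∧ r.val + s.val < N ∧
      ∀ a ∈ fermatCMType N r s (-(r + s)), ∀ b ∈ fermatCMType N r s (-(r + s)), a * b ∈ fermatCMType N r s (-(r + s))) ↔
    7 ∣ N := by
  constructor
  · rintro ⟨r, s, hr, hs, hrs, hcl⟩
    exact seven_dvd_of_forall_mul_mem_coprimeSix hN2 hN3 hr hs hrs hcl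
  · rintro ⟨g, hg⟩
    have hN0 : 0 < N := Nat.pos_of_ne_zero (NeZero.ne N)
    have hg0 : 0 < g := Nat.pos_of_ne_zero (by rintro rfl; rw [mul_zero] at hg; omega)
    have hgN : g * 7 = N := by rw [mul_comm]; exact hg.symm
    have hrv : (((g : ℕ) : ZMod N)).val = g := by rw [ZMod.val_natCast, Nat.mod_eq_of_lt (by omega)]
    have hsv : (((2 * g : ℕ) : ZMod N)).val = 2 * g := by rw [ZMod.val_natCast, Nat.mod_eq_of_lt (by omega)]
    refine ⟨((g : ℕ) : ZMod N), ((2 * g : ℕ) : ZMod N), ?_, ?_, ?_, forall_mul_mem_seven_mul hg0 hgN⟩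
    · intro h
      have := (ZMod.val_eq_zero _).2 h
      rw [hrv] at this
      omega
    · intro h
      have := (ZMod.val_eq_zero _).2 h
      rw [hsv] at this
      omega
    · rw [hrv, hsv]; omega

end AllTriples

/-! ## §4 Prime level: an elliptic Koblitz–Rohrlich factor type of `ℚ(ζ_p)` exists iff `p = 7` -/

section PrimeLevel

variable {p : ℕ} [NeZero p]

/-- At a prime level every admissible pair is primitive: `gcd(gcd(⟨r⟩, ⟨s⟩), p) = 1` for `r ≠ 0`. [cite: KoblitzRohrlich1978, §1 (p. 1184:
«if g.c.d.`(r, N) = 1`, we may assume that the pair is actually `(1, s)`»)] -/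
theorem gcd_gcd_eq_one_of_prime (hp : p.Prime) {r s : ZMod p} (hr : r ≠ 0) : Nat.gcd (Nat.gcd r.val s.val) p = 1 := by
  have hrv : 0 < r.val := Nat.pos_of_ne_zero fun h => hr ((ZMod.val_eq_zero r).1 h)
  have hcop : Nat.Coprime r.val p := (Nat.coprime_of_lt_prime hrv.ne' (ZMod.val_lt r) hp).symm
  exact Nat.Coprime.coprime_dvd_left (Nat.gcd_dvd_left _ _) hcop

/-- **PRIME LEVEL: `H_{r,s,t}` closed ⟹ `p = 7`** for every admissible normalised triple modulo a prime `p ≥ 5`.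
[cite: BauerCosteItzyksonRuelle1997, §3.4] [cite: KoblitzRohrlich1978, Theorem 2 (pp. 1185–1186: «if `N` equals a prime `p`, then all the
factors `L_{r,s,t}` are simple if `p ≡ 2 mod 3`, and all but two are simple if `p ≡ 1 mod 3`»)] -/
theorem eq_seven_of_forall_mul_mem_prime (hp : p.Prime) (h5 : 5 ≤ p) {r s : ZMod p} (hr : r ≠ 0) (hs : s ≠ 0)
    (hrs : r.val + s.val < p)
    (hcl : ∀ a ∈ fermatCMType p r s (-(r + s)), ∀ b ∈ fermatCMType p r s (-(r + s)), a * b ∈ fermatCMType p r s (-(r + s))) :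
    p = 7 := by
  have hp2 : Nat.Coprime 2 p := (Nat.coprime_primes Nat.prime_two hp).2 (by omega)
  have hp3 : Nat.Coprime 3 p := (Nat.coprime_primes Nat.prime_three hp).2 (by omega)
  exact (exists_primitive_group_triple_iff_coprimeSix p (by omega) hp2 hp3).1
    ⟨r, s, hr, hs, hrs, gcd_gcd_eq_one_of_prime hp hr, hcl⟩

/-- **PRIME LEVEL, IFF: for a prime `p ≥ 5` an admissible normalised triple modulo `p` with `H` a group exists iff `p = 7`** (`(1, 2, 4)` at
`7`: `A_{1,2,4} ∼ E³`, `E` with CM by `ℚ(√−7)`; Koblitz's list meets the primes `≥ 5` in `{7}`).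
[cite: BauerCosteItzyksonRuelle1997, §3.3–§3.4] [cite: KoblitzRohrlich1978, Theorem 2 (pp. 1185–1186)] -/
theorem exists_group_triple_iff_of_prime (hp : p.Prime) (h5 : 5 ≤ p) :
    (∃ r s : ZMod p, r ≠ 0 ∧ s ≠ 0 ∧ r.val + s.val < p ∧
      ∀ a ∈ fermatCMType p r s (-(r + s)), ∀ b ∈ fermatCMType p r s (-(r + s)), a * b ∈ fermatCMType p r s (-(r + s))) ↔
    p = 7 := by
  constructor
  · rintro ⟨r, s, hr, hs, hrs, hcl⟩
    exact eq_seven_of_forall_mul_mem_prime hp h5 hr hs hrs hcl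
  · rintro rfl
    obtain ⟨r, s, hr, hs, hrs, -, hcl⟩ :=
      exists_primitive_group_triple_of_mem_koblitzList (n := 7) (by decide)
    exact ⟨r, s, hr, hs, hrs, hcl⟩

end PrimeLevel

section PrimeLevelSeven

/-- **Gordon's `S_a = H_{1,a,−1−a}` at prime level `p ≥ 5`: `S_a` is closed under multiplication iff `p = 7` and `a ∈ {2, 4}`** (the two
orderings of `(1, 2, 4)`; at `7` the other three types `S_1, S_3, S_5` are not closed — kernel at the single level `7`).
[cite: KoblitzRohrlich1978, Theorem 2 (pp. 1185–1186)] [cite: BauerCosteItzyksonRuelle1997, §3.3] -/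
theorem forall_mul_mem_fermat_one_iff_seven {p : ℕ} [hpz : NeZero p] (hp : p.Prime) (h5 : 5 ≤ p) {a : ZMod p} (ha : a ≠ 0)
    (ha' : (-1 - a : ZMod p) ≠ 0) :
    (∀ x ∈ fermatCMType p 1 a (-1 - a), ∀ y ∈ fermatCMType p 1 a (-1 - a), x * y ∈ fermatCMType p 1 a (-1 - a)) ↔
      p = 7 ∧ (a.val = 2 ∨ a.val = 4) := by
  haveI : Fact (1 < p) := ⟨hp.one_lt⟩
  have hrs : (1 : ZMod p).val + a.val < p := by
    -- `⟨a⟩ ≤ p − 1`, and `⟨a⟩ = p − 1` would give `−1 − a = 0`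
    have hlt := ZMod.val_lt a
    rw [ZMod.val_one]
    by_contra h
    have hav : a.val = p - 1 := by omega
    apply ha'
    have : a = -1 := by
      have h1 : ((a.val : ℕ) : ZMod p) = ((p - 1 : ℕ) : ZMod p) := by rw [hav]
      rw [ZMod.natCast_zmod_val, Nat.cast_sub hp.one_le, ZMod.natCast_self, zero_sub, Nat.cast_one] at h1
      exact h1
    rw [this]; ring
  have key : fermatCMType p 1 a (-1 - a) = fermatCMType p 1 a (-(1 + a)) := by
    congr 1; ring
  constructor
  · intro hcl
    rw [key] at hcl
    have h7 := eq_seven_of_forall_mul_mem_prime hp h5 one_ne_zero ha hrs hcl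
    subst h7
    -- replace the instance hypothesis by the closed instance so that `decide` runs
    obtain rfl : hpz = ⟨by decide⟩ := Subsingleton.elim _ _
    refine ⟨rfl, ?_⟩
    clear key hrs
    revert hcl ha' ha a
    decide
  · rintro ⟨rfl, hav⟩
    obtain rfl : hpz = ⟨by decide⟩ := Subsingleton.elim _ _
    have haeq : a = ((a.val : ℕ) : ZMod 7) := (ZMod.natCast_zmod_val a).symm
    rcases hav with h | h <;> (rw [haeq, h]; decide)

end PrimeLevelSeven


/-! ## §5 Every level `n`: the tail of Koblitz's list is confined to levels divisible by `2` or `3` -/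

section AllLevels

/-- **KOBLITZ'S LIST AS PRINTED, AT EVERY LEVEL `n`, WITH THE TAIL CONFINED TO `2 ∣ n₀ ∨ 3 ∣ n₀`**: for every admissible normalised triple
`(r, s, −r−s)` modulo `n` (no primitivity, no bound on `n`) with `H_{r,s,t}` closed under multiplication, `n₀ = n ∕ gcd(gcd(⟨r⟩,⟨s⟩), n)` lies
in `{3, 4, 6, 7, 8, 12, 15, 16, 18, 20, 21, 22, 24, 30, 39, 40, 48, 60}` OR (`n₀ > 72` AND `n₀` is divisible by `2` or `3`) — the prequel's
statement (census `n₀ ≤ 72`) with the levels prime to `6` now settled for good by §2. [cite: BauerCosteItzyksonRuelle1997, §3.4]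
[cite: KoblitzRohrlich1978, Theorem 2 (pp. 1185–1186), §2 (p. 1187)] -/
theorem n0_mem_koblitzList_or_of_forall_mul_mem (n : ℕ) [NeZero n] {r s : ZMod n} (hr : r ≠ 0) (hs : s ≠ 0)
    (hrs : r.val + s.val < n)
    (hcl : ∀ a ∈ fermatCMType n r s (-(r + s)), ∀ b ∈ fermatCMType n r s (-(r + s)), a * b ∈ fermatCMType n r s (-(r + s))) :
    n / Nat.gcd (Nat.gcd r.val s.val) n ∈ ({3, 4, 6, 7, 8, 12, 15, 16, 18, 20, 21, 22, 24, 30, 39, 40, 48, 60} : Finset ℕ) ∨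
      (72 < n / Nat.gcd (Nat.gcd r.val s.val) n ∧
        (2 ∣ n / Nat.gcd (Nat.gcd r.val s.val) n ∨ 3 ∣ n / Nat.gcd (Nat.gcd r.val s.val) n)) := by
  obtain ⟨g, m, r₁, s₁, hg, hn, hm, hr1, hs1, hr0, hs0, hlt, h3, hprim⟩ := exists_reduced_primitive hr hs hrs
  rw [hm]
  haveI : NeZero m := ⟨by omega⟩
  have hcl' := (forall_mul_mem_iff_reduced hn hg hr1 hs1 hr0 hlt).1 hcl
  have hr1v : ((r₁ : ℕ) : ZMod m).val = r₁ := by rw [ZMod.val_natCast, Nat.mod_eq_of_lt (by omega)]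
  have hs1v : ((s₁ : ℕ) : ZMod m).val = s₁ := by rw [ZMod.val_natCast, Nat.mod_eq_of_lt (by omega)]
  have hr' : ((r₁ : ℕ) : ZMod m) ≠ 0 := fun h => by
    have h1 := (ZMod.val_eq_zero _).2 h
    rw [hr1v] at h1
    omega
  have hs' : ((s₁ : ℕ) : ZMod m) ≠ 0 := fun h => by
    have h1 := (ZMod.val_eq_zero _).2 h
    rw [hs1v] at h1
    omega
  have hlt' : ((r₁ : ℕ) : ZMod m).val + ((s₁ : ℕ) : ZMod m).val < m := by rw [hr1v, hs1v]; exact hlt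
  have hprim' : Nat.gcd (Nat.gcd ((r₁ : ℕ) : ZMod m).val ((s₁ : ℕ) : ZMod m).val) m = 1 := by rw [hr1v, hs1v]; exact hprim
  by_cases h72 : m ≤ 72
  · exact Or.inl ((exists_primitive_group_triple_iff_of_le_seventyTwo m h3 h72).1 ⟨_, _, hr', hs', hlt', hprim', hcl'⟩)
  · refine Or.inr ⟨by omega, ?_⟩
    by_contra h23
    have hm2 : Nat.Coprime 2 m := (Nat.Prime.coprime_iff_not_dvd Nat.prime_two).2 fun h => h23 (Or.inl h)
    have hm3 : Nat.Coprime 3 m := (Nat.Prime.coprime_iff_not_dvd Nat.prime_three).2 fun h => h23 (Or.inr h)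
    have h7 := (exists_primitive_group_triple_iff_coprimeSix m h3 hm2 hm3).1 ⟨_, _, hr', hs', hlt', hprim', hcl'⟩
    omega

end AllLevels

/-! ## §6 On abelian varieties -/

section Varieties

variable {N : ℕ} [NeZero N] {L : Type} [Field L] [NumberField L] [IsCyclotomicExtension {N} ℚ L]

/-- **«No `L_{r,s,t}` is isogenous to a product of elliptic factors unless `n₀ = 7`» AT A LEVEL PRIME TO `6`, ON ABELIAN VARIETIES**: for every
admissible normalised triple modulo `N`, `gcd(N, 6) = 1`, and any realisation `A` of the K–R type `Φ_{H_{r,s,−r−s}}` of `ℚ(ζ_N)`: if `A` is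
isogenous to a power of an elliptic curve then `n₀ = 7`. [cite: BauerCosteItzyksonRuelle1997, §3.4] [cite: KoblitzRohrlich1978, §1 p. 1184, Theorem 2] -/
theorem n0_eq_seven_of_exists_isIsogeny_pow_elliptic_coprimeSix (hN2 : Nat.Coprime 2 N) (hN3 : Nat.Coprime 3 N) {r s : ZMod N}
    (hr : r ≠ 0) (hs : s ≠ 0) (hrs : r.val + s.val < N)
    {hS : ∀ c : ZMod N, c.val.Coprime N → (c ∈ fermatCMType N r s (-(r + s)) ↔ -c ∉ fermatCMType N r s (-(r + s)))}
    {A : AbelianVariety ℂ} {ι : 𝓞 L →+* End A} {θ : L →+* Module.End ℂ (complexBetti A.X 1)}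
    (hA : IsCMTypeRealisation (cmTypeOfResidues (L := L) (fermatCMType N r s (-(r + s))) hS) A ι θ)
    (hE : ∃ (E P : AbelianVariety ℂ) (h : ℕ) (π : Fin h → (P ⟶ E)) (g : A ⟶ P),
      E.dim = 1 ∧ Nonempty (IsLimit (Fan.mk P π)) ∧ IsIsogeny g) :
    N / Nat.gcd (Nat.gcd r.val s.val) N = 7 := by
  have hrv : 0 < r.val := Nat.pos_of_ne_zero fun h => hr ((ZMod.val_eq_zero r).1 h)
  have hsv : 0 < s.val := Nat.pos_of_ne_zero fun h => hs ((ZMod.val_eq_zero s).1 h)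
  have hn2 : 2 < N := by omega
  haveI : IsCMField L := IsCyclotomicExtension.Rat.isCMField L (S := {N}) ⟨N, rfl, hn2⟩
  have hcl := (exists_isIsogeny_pow_elliptic_fermat_iff_forall_mul_mem hn2 (one_mem_fermatCMType_of_val_add_lt hr hrs) hA).1 hE
  exact n0_eq_seven_of_forall_mul_mem_coprimeSix hN2 hN3 hr hs hrs hcl

/-- **NO ELLIPTIC SPLITTING AT A LEVEL PRIME TO `42`**: if `gcd(N, 6) = 1` and `7 ∤ N`, no realisation of any K–R factor type `Φ_{H_τ}` of
`ℚ(ζ_N)` (any admissible normalised `τ`) is isogenous to a power of an elliptic curve. [cite: BauerCosteItzyksonRuelle1997, §3.4]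
[cite: KoblitzRohrlich1978, §1 p. 1184, Theorem 2] -/
theorem not_exists_isIsogeny_pow_elliptic_coprimeSix_of_not_dvd (hN2 : Nat.Coprime 2 N) (hN3 : Nat.Coprime 3 N) (hN7 : ¬7 ∣ N)
    {r s : ZMod N} (hr : r ≠ 0) (hs : s ≠ 0) (hrs : r.val + s.val < N)
    {hS : ∀ c : ZMod N, c.val.Coprime N → (c ∈ fermatCMType N r s (-(r + s)) ↔ -c ∉ fermatCMType N r s (-(r + s)))}
    {A : AbelianVariety ℂ} {ι : 𝓞 L →+* End A} {θ : L →+* Module.End ℂ (complexBetti A.X 1)}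
    (hA : IsCMTypeRealisation (cmTypeOfResidues (L := L) (fermatCMType N r s (-(r + s))) hS) A ι θ) :
    ¬∃ (E P : AbelianVariety ℂ) (h : ℕ) (π : Fin h → (P ⟶ E)) (g : A ⟶ P),
      E.dim = 1 ∧ Nonempty (IsLimit (Fan.mk P π)) ∧ IsIsogeny g := by
  intro hE
  have hrv : 0 < r.val := Nat.pos_of_ne_zero fun h => hr ((ZMod.val_eq_zero r).1 h)
  have hsv : 0 < s.val := Nat.pos_of_ne_zero fun h => hs ((ZMod.val_eq_zero s).1 h)
  have hn2 : 2 < N := by omega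
  haveI : IsCMField L := IsCyclotomicExtension.Rat.isCMField L (S := {N}) ⟨N, rfl, hn2⟩
  have hcl := (exists_isIsogeny_pow_elliptic_fermat_iff_forall_mul_mem hn2 (one_mem_fermatCMType_of_val_add_lt hr hrs) hA).1 hE
  exact not_forall_mul_mem_coprimeSix_of_not_dvd hN2 hN3 hN7 hr hs hrs hcl

/-- **PRIME LEVEL ON ABELIAN VARIETIES: a realisation of a K–R factor type of `ℚ(ζ_p)`, `p ≥ 5` prime, is isogenous to a power of an
elliptic curve only if `p = 7`.** [cite: BauerCosteItzyksonRuelle1997, §3.3–§3.4] [cite: KoblitzRohrlich1978, §1 p. 1184, Theorem 2] -/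
theorem eq_seven_of_exists_isIsogeny_pow_elliptic_prime (hp : N.Prime) (h5 : 5 ≤ N) {r s : ZMod N} (hr : r ≠ 0) (hs : s ≠ 0)
    (hrs : r.val + s.val < N)
    {hS : ∀ c : ZMod N, c.val.Coprime N → (c ∈ fermatCMType N r s (-(r + s)) ↔ -c ∉ fermatCMType N r s (-(r + s)))}
    {A : AbelianVariety ℂ} {ι : 𝓞 L →+* End A} {θ : L →+* Module.End ℂ (complexBetti A.X 1)}
    (hA : IsCMTypeRealisation (cmTypeOfResidues (L := L) (fermatCMType N r s (-(r + s))) hS) A ι θ)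
    (hE : ∃ (E P : AbelianVariety ℂ) (h : ℕ) (π : Fin h → (P ⟶ E)) (g : A ⟶ P),
      E.dim = 1 ∧ Nonempty (IsLimit (Fan.mk P π)) ∧ IsIsogeny g) :
    N = 7 := by
  have hn2 : 2 < N := by omega
  haveI : IsCMField L := IsCyclotomicExtension.Rat.isCMField L (S := {N}) ⟨N, rfl, hn2⟩
  have hcl := (exists_isIsogeny_pow_elliptic_fermat_iff_forall_mul_mem hn2 (one_mem_fermatCMType_of_val_add_lt hr hrs) hA).1 hE
  exact eq_seven_of_forall_mul_mem_prime hp h5 hr hs hrs hcl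

/-- **KOBLITZ'S LIST ON ABELIAN VARIETIES AT EVERY LEVEL `n`, TAIL CONFINED TO `2 ∣ n₀ ∨ 3 ∣ n₀`**: for every admissible normalised triple
modulo `n` and any realisation `A` of `Φ_{H_{r,s,−r−s}}`: if `A` is isogenous to a power of an elliptic curve then `n₀ ∈` the printed set, or
`n₀ > 72` with `2 ∣ n₀` or `3 ∣ n₀`. [cite: BauerCosteItzyksonRuelle1997, §3.4] [cite: KoblitzRohrlich1978, §1 p. 1184, Theorem 2] -/
theorem n0_mem_koblitzList_or_of_exists_isIsogeny_pow_elliptic {r s : ZMod N} (hr : r ≠ 0) (hs : s ≠ 0)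
    (hrs : r.val + s.val < N)
    {hS : ∀ c : ZMod N, c.val.Coprime N → (c ∈ fermatCMType N r s (-(r + s)) ↔ -c ∉ fermatCMType N r s (-(r + s)))}
    {A : AbelianVariety ℂ} {ι : 𝓞 L →+* End A} {θ : L →+* Module.End ℂ (complexBetti A.X 1)}
    (hA : IsCMTypeRealisation (cmTypeOfResidues (L := L) (fermatCMType N r s (-(r + s))) hS) A ι θ)
    (hE : ∃ (E P : AbelianVariety ℂ) (h : ℕ) (π : Fin h → (P ⟶ E)) (g : A ⟶ P),
      E.dim = 1 ∧ Nonempty (IsLimit (Fan.mk P π)) ∧ IsIsogeny g) :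
    N / Nat.gcd (Nat.gcd r.val s.val) N ∈ ({3, 4, 6, 7, 8, 12, 15, 16, 18, 20, 21, 22, 24, 30, 39, 40, 48, 60} : Finset ℕ) ∨
      (72 < N / Nat.gcd (Nat.gcd r.val s.val) N ∧
        (2 ∣ N / Nat.gcd (Nat.gcd r.val s.val) N ∨ 3 ∣ N / Nat.gcd (Nat.gcd r.val s.val) N)) := by
  have hrv : 0 < r.val := Nat.pos_of_ne_zero fun h => hr ((ZMod.val_eq_zero r).1 h)
  have hsv : 0 < s.val := Nat.pos_of_ne_zero fun h => hs ((ZMod.val_eq_zero s).1 h)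
  have hn2 : 2 < N := by omega
  haveI : IsCMField L := IsCyclotomicExtension.Rat.isCMField L (S := {N}) ⟨N, rfl, hn2⟩
  have hcl := (exists_isIsogeny_pow_elliptic_fermat_iff_forall_mul_mem hn2 (one_mem_fermatCMType_of_val_add_lt hr hrs) hA).1 hE
  exact n0_mem_koblitzList_or_of_forall_mul_mem N hr hs hrs hcl

end Varieties

end CyclotomicFermatCMType

end Literature.AlgebraicGeometry.ComplexMultiplication
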